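import Mathlib
import Literature.NumberTheory.Automorphic.ConjSelfDualParityDiagonal
import HarnessLib

/-!
# Mok's `L`-embeddings `ξ_{χ_κ}` and Lemma 2.2.1: parameters of `U_{E/F}(N)` versus conjugate self-dual
# parameters of parity `(-1)^{N-1} κ`

Topic `NumberTheory/Automorphic`; namespace `Literature.NumberTheory.Automorphic`.  Theorem file (definitions
with bodies and proved theorems only — no named fact, no `sorry`; provefact unit
`Mok2014_archimedean_parity_of_asaiSign`, 2026-08-16, session 5), companion of `ConjSelfDualParityDiagonal`
(the matrix-level parity (2.2.6) of diagonal parameters of `W_ℂ`).  It formalizes the second local ingredient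
of the printed proof of Mok's Cor. 2.5.5 (C. P. Mok, *Endoscopic classification of representations of
quasi-split unitary groups*, Mem. AMS 235 (2015), no. 1108): §2.1 (the `L`-group `ᴸU_{E/F}(N)`, the
characters `χ_κ ∈ 𝒵_E^κ`, (2.1.7)–(2.1.9)) and **Lemma 2.2.1** ("the image of `ξ_{χ_κ,*}` is given by the set
of parameters in `Φ(GL_N(E))` that are conjugate self-dual with parity `η = (-1)^{N-1} κ`", = Gan–Gross–Prasad,
Thm. 8.1), with Mok's printed proof ((2.2.7), (2.2.8), `A := Φ_N C⁻¹`, `C := A⁻¹ Φ_N`) followed line by line.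

## Setting (abstract index-two Weil datum)

Everything in Lemma 2.2.1 is algebra in the following datum, which we take abstractly so that one proof serves
the archimedean place (`L_F = W_ℝ ⊃ W_ℂ = ℂˣ`, instantiated in the last section) and, later, the
non-archimedean ones (`L_F = W_F × SU(2) ⊃ L_E`): a group `W` (= `L_F`), a homomorphism `s : W → {±1}`
(= `W_F → W_F/W_E = Gal(E/F)`) with kernel `W_E`, and an element `w_c` with `s(w_c) = -1`
(`w_c ∈ W_F ∖ W_E`; then `w_c² ∈ W_E`, `wcSq`).  Coefficients: any commutative ring `R` (the source: `ℂ`).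

## What is here

* `transposeGL`, `scalarGL`, `signGL` — transpose, scalars and signs in `GL_n(R)`; `mokPhi` / `mokPhiGL` —
  Mok's `Φ_N` (1.0.2) with `ᵗΦ_N = (-1)^{N-1} Φ_N`, `Φ_N² = (-1)^{N-1}` (`transpose_mokPhi`,
  `mokPhi_mul_mokPhi`); `mokAlpha` / `mokAlphaAut` — `α(g) = Φ_N ᵗg⁻¹ Φ_N⁻¹`, multiplicative and of order two
  (`mokAlpha_mokAlpha`).
* `conjParam` — `ρ^c(σ) = ρ(w_c⁻¹ σ w_c)` (2.2.3); `IsConjSelfDualCharOfSign` — `χ_κ ∈ 𝒵_E^κ` on `W_E`,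
  (2.1.7)–(2.1.8); `twistParam` — `ρ ⊗ χ`; `IsConjSelfDualOfParityGL` — (2.2.5)–(2.2.6) in `GL_n`;
  `IsConjSelfDualOfParityGL.of_eq_conj` — parity is a class invariant.
* `IsUnitaryLParamData s w_c ρ C` — the datum `(ρ = φ|_{W_E}, φ(w_c) = C ⋊ w_c)` of a parameter of
  `U_{E/F}(N)` with its two relations; `lGroupUAct`, `LGroupU R N s = GL_N(R) ⋊ W` — the `L`-group
  `ᴸU_{E/F}(N)` (Mathlib `SemidirectProduct`); `IsLHom` — homomorphisms `W → ᴸU(N)` over `W`;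
  `IsLHom.isUnitaryLParamData` — an actual `L`-homomorphism yields the datum (Mok's "direct computation").
* **Lemma 2.2.1**: `IsUnitaryLParamData.isConjSelfDualOfParityGL_twistParam` (`⊆`: `ρ ⊗ χ_κ` is conjugate
  self-dual of parity `(-1)^{N-1} κ`, form `A = Φ_N C⁻¹`),
  `IsConjSelfDualOfParityGL.exists_isUnitaryLParamData_twistParam_inv` (`⊇`: `ρ' ⊗ χ_κ⁻¹` with
  `C = A⁻¹ Φ_N` is a parameter datum of `U(N)`), packaged as
  `isConjSelfDualOfParityGL_iff_exists_isUnitaryLParamData`; for `L`-homomorphisms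
  `IsLHom.isConjSelfDualOfParityGL_twistParam` and (standard base change, `χ_+ = 1`)
  `IsLHom.isConjSelfDualOfParityGL_restrict`.
* The archimedean instance: `WeilGroupReal` (`W_ℝ = ℂˣ ⊔ ℂˣ j`, `j z j⁻¹ = z̄`, `j² = -1`, a `Group`),
  `WeilGroupReal.sign : W_ℝ → {±1}` with kernel `W_ℂ ≃ ℂˣ` (`unitsEquivKer`), `kerConj_unitsEquivKer`
  (`j⁻¹ z j = z̄`), `wcSq_sign_j` (`j² = -1`); the bridge `isConjSelfDualOfParityGL_archParamGL_iff` to the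
  matrix-form parity `IsConjSelfDualOfParity` of `ConjSelfDualParityDiagonal`; the characters
  `(z/|z|)^m ∈ 𝒵_ℂ^{(-1)^m}` (`isConjSelfDualCharOfSign_archUnitArgChar`); and the assembled local statement
  `exists_half_eq_of_isLHom_of_eq_conj_unitaryDiagParam`: **if `φ : W_ℝ → ᴸU(N)` is an `L`-homomorphism and
  `φ|_{W_ℂ} ⊗ χ_κ` is conjugate to the multiplicity-free shape (2.5.12) `diag((z/|z|)^{m_i})`, then every
  `a_i = m_i/2` lies in `(N-1)/2 + (1-κ)/4 + ℤ`** — the conclusion of the named facts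
  `Mok2014_archimedean_parity_of_asaiSign(Cont)` (`AsaiSign`, `AsaiSignCont`) from the conclusion of Mok's
  Thm. 2.4.10 at the archimedean place.

## What is NOT here

* Mok's Thm. 2.4.10 (the localization of a conjugate self-dual cuspidal `Π` of sign `κ` factors through
  `ξ_{χ_κ}`; trace formula) and the local Langlands correspondence for `GL_N(ℂ)` (tying `HasArchParameter` to
  `φ^N_v`): the two global/representation-theoretic inputs of Cor. 2.5.5, not in the tree.
* Topology / admissibility of parameters (irrelevant to the algebra of Lemma 2.2.1), the `SU(2)`-factor, the
  `L`-group `ᴸG_{E/F}(N) = (GL_N × GL_N) ⋊ W_F` and `ξ_{χ_κ}` as a homomorphism on it: as in the source, the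
  identification `Φ(G_{E/F}(N)) ≅ Φ(GL_N(E))` ([R] p. 48, (2.2.2)), under which `ξ_{χ_κ} ∘ φ` corresponds to
  `φ|_{L_E} ⊗ χ_κ`, is taken as the description of the left-hand side of the Lemma; and the converse
  packaging "every datum `(ρ, C)` comes from an `L`-homomorphism" (an index-two extension lemma) is not needed.

## References

* C. P. Mok, *Endoscopic classification of representations of quasi-split unitary groups*, Mem. Amer. Math.
  Soc. 235 (2015), no. 1108 (arXiv:1206.0882): (1.0.2) and §2.1 (pp. 5–7: `Φ_N`, `α`, `ᴸU_{E/F}(N)`,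
  `𝒵_E^±`, (2.1.7)–(2.1.9)), §2.2 (pp. 8–9: (2.2.1)–(2.2.8), Lemma 2.2.1 with proof, Remark 2.2.2),
  Example and Cor. 2.5.5 (p. 21). [Mok2014]
* W. T. Gan, B. H. Gross, D. Prasad, *Symplectic local root numbers, central critical `L`-values, and
  restriction problems in the representation theory of classical groups*, Astérisque 346 (2012), §3 and
  Thm. 8.1. [GanGrossPrasad2012]
* J. Tate, *Number theoretic background*, Proc. Symp. Pure Math. 33 (Corvallis 1979), part 2, (1.4.3)
  (`W_ℝ = ℂˣ ∪ j ℂˣ`).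

## Mathlib search / design

Mathlib (this pin) has `SemidirectProduct` (`N ⋊[φ] G`, `inl`, `mul_left`, `inv_left`), `MulAut.conjNormal`,
`MonoidHom.toHomUnits`, `Matrix.GeneralLinearGroup`, but no Weil group of `ℝ`, no `L`-groups of unitary
groups, and no transpose on `GL_n` as a map `GL_n → GL_n` (the tree has `ᵐᵒᵖ`-valued / other-namespace
variants: `glTranspose` of `CartanDecompositionGLn` over valued fields, `transposeGL` in
`Computability.AlgebraicComplexity` and `NumberTheory.DiophantineGeometry`; the five-line `transposeGL` here is
over a commutative ring and in this namespace, nothing is re-declared under an existing fully qualified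
name).  Identities in `GL_N` are proved by distributing transposes in the group (`transposeGL_mul/inv`) and
then passing to matrices (`Units.ext`), where central scalars float out of products and cancel.  Only `simp only` sets are used on
such words, so that unit inverses stay syntactically `↑(g⁻¹)` (no `Matrix.coe_units_inv`).
-/

noncomputable section

open scoped Matrix ComplexConjugate
open Matrix

namespace Literature.NumberTheory.Automorphic

/-! ## Signs and transposes in `GL_n(R)` -/

section GLToolbox

variable {R : Type*} [CommRing R] {n : Type*} [Fintype n] [DecidableEq n]

/-- `(-1)^k ((-1)^k x) = x`. [folklore] -/
theorem neg_one_pow_mul_neg_one_pow_mul_self (k : ℕ) (x : R) : (-1 : R) ^ k * ((-1) ^ k * x) = x := by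
  rw [← mul_assoc, ← pow_add, ← two_mul, pow_mul, neg_one_sq, one_pow, one_mul]

/-- The **transpose of an invertible matrix**, as an invertible matrix (`(ᵗg)⁻¹ = ᵗ(g⁻¹)`). [folklore] -/
def transposeGL (g : GL n R) : GL n R where
  val := (g : Matrix n n R)ᵀ
  inv := ((g⁻¹ : GL n R) : Matrix n n R)ᵀ
  val_inv := by rw [← transpose_mul, Units.inv_mul, transpose_one]
  inv_val := by rw [← transpose_mul, Units.mul_inv, transpose_one]

/-- The matrix of `ᵗg` is the transpose of the matrix of `g`. [folklore] -/
theorem coe_transposeGL (g : GL n R) : ((transposeGL g : GL n R) : Matrix n n R) = (g : Matrix n n R)ᵀ :=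
  rfl

/-- Transposition is an anti-automorphism: `ᵗ(gh) = ᵗh ᵗg`. [folklore] -/
theorem transposeGL_mul (g h : GL n R) : transposeGL (g * h) = transposeGL h * transposeGL g :=
  Units.ext (by simp [coe_transposeGL, transpose_mul])

/-- `ᵗ1 = 1`. [folklore] -/
@[simp]
theorem transposeGL_one : transposeGL (1 : GL n R) = 1 :=
  Units.ext (by simp [coe_transposeGL])

/-- `ᵗ(g⁻¹) = (ᵗg)⁻¹`. [folklore] -/
theorem transposeGL_inv (g : GL n R) : transposeGL g⁻¹ = (transposeGL g)⁻¹ :=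
  eq_inv_of_mul_eq_one_left (by rw [← transposeGL_mul, mul_inv_cancel, transposeGL_one])

/-- `ᵗᵗg = g`. [folklore] -/
@[simp]
theorem transposeGL_transposeGL (g : GL n R) : transposeGL (transposeGL g) = g :=
  Units.ext (transpose_transpose _)

/-- The scalar invertible matrices `u I_n`, `u ∈ Rˣ`. [folklore] -/
def scalarGL : Rˣ →* GL n R :=
  Units.map (Matrix.scalar n : R →+* Matrix n n R).toMonoidHom

/-- The matrix of `u I_n` is `u • 1`. [folklore] -/
@[simp]
theorem coe_scalarGL (u : Rˣ) : ((scalarGL u : GL n R) : Matrix n n R) = (u : R) • (1 : Matrix n n R) := by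
  simp [scalarGL, smul_one_eq_diagonal]

/-- Scalar matrices are central. [folklore] -/
theorem scalarGL_comm (u : Rˣ) (g : GL n R) : scalarGL u * g = g * scalarGL u :=
  Units.ext (by simp)

/-- `(u I)⁻¹ = u⁻¹ I` (normal form: keep `scalarGL` applied to a unit). [folklore] -/
theorem scalarGL_inv' (u : Rˣ) : (scalarGL u : GL n R)⁻¹ = scalarGL u⁻¹ :=
  (map_inv scalarGL u).symm

/-- Scalar matrices are symmetric. [folklore] -/
@[simp]
theorem transposeGL_scalarGL (u : Rˣ) : transposeGL (scalarGL u : GL n R) = scalarGL u :=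
  Units.ext (by simp [coe_transposeGL])

/-- The sign `ε ∈ ℤˣ = {±1}` as a unit of `R`. [folklore] -/
def signUnit (R : Type*) [CommRing R] : ℤˣ →* Rˣ :=
  Units.map (Int.castRingHom R).toMonoidHom

/-- The unit `ε ∈ Rˣ` has value the cast of `ε`. [folklore] -/
@[simp]
theorem coe_signUnit (ε : ℤˣ) : ((signUnit R ε : Rˣ) : R) = ((ε : ℤ) : R) :=
  rfl

/-- `ε⁻¹ = ε` for a sign. [folklore] -/
theorem signUnit_inv (ε : ℤˣ) : (signUnit R ε)⁻¹ = signUnit R ε := by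
  rw [← map_inv, Int.units_inv_eq_self]

/-- `ε · ε = 1` in `R` for a sign `ε ∈ ℤˣ`. [folklore] -/
theorem intUnits_cast_mul_self (ε : ℤˣ) : ((ε : ℤ) : R) * ((ε : ℤ) : R) = 1 := by
  rcases Int.units_eq_one_or ε with rfl | rfl <;> simp

/-- The central signs `ε I_n ∈ GL_n(R)`, `ε ∈ {±1}`. [folklore] -/
def signGL : ℤˣ →* GL n R :=
  (scalarGL : Rˣ →* GL n R).comp (signUnit R)

/-- The matrix of `ε I_n` is `ε • 1`. [folklore] -/
@[simp]
theorem coe_signGL (ε : ℤˣ) : ((signGL ε : GL n R) : Matrix n n R) = ((ε : ℤ) : R) • (1 : Matrix n n R) := by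
  simp [signGL]

/-- `(ε I)(ε I) = I` for a sign `ε`. [folklore] -/
theorem signGL_mul_self (ε : ℤˣ) : (signGL ε : GL n R) * signGL ε = 1 := by
  rw [← map_mul, Int.units_mul_self, map_one]

/-- `(ε I)⁻¹ = ε I` for a sign `ε`. [folklore] -/
theorem signGL_inv (ε : ℤˣ) : (signGL ε : GL n R)⁻¹ = signGL ε :=
  inv_eq_of_mul_eq_one_right (signGL_mul_self ε)

/-- The signs `ε I_n` are central. [folklore] -/
theorem signGL_comm (ε : ℤˣ) (g : GL n R) : signGL ε * g = g * signGL ε :=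
  scalarGL_comm _ g

/-- `ᵗ(ε I) = ε I`. [folklore] -/
@[simp]
theorem transposeGL_signGL (ε : ℤˣ) : transposeGL (signGL ε : GL n R) = signGL ε :=
  transposeGL_scalarGL _

/-- The cast of the sign `(-1)^k ∈ ℤˣ` to `R`. [folklore] -/
theorem intUnits_cast_neg_one_pow (k : ℕ) : ((((-1 : ℤˣ) ^ k : ℤˣ) : ℤ) : R) = (-1 : R) ^ k := by
  rcases Nat.even_or_odd k with h | h
  · have h1 : ((-1 : ℤˣ) ^ k) = 1 := h.neg_one_pow
    rw [h1, h.neg_one_pow]; simp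
  · have h1 : ((-1 : ℤˣ) ^ k) = -1 := h.neg_one_pow
    rw [h1, h.neg_one_pow]; simp

/-- The cast of the sign `(-1)^{N-1} κ` (spelled `(-1)^(N+1) * κ` in `ℤˣ`). [folklore] -/
theorem intUnits_cast_neg_one_pow_mul' (N : ℕ) (κ : ℤˣ) :
    ((((-1 : ℤˣ) ^ (N + 1) * κ : ℤˣ) : ℤ) : R) = (-1 : R) ^ (N + 1) * ((κ : ℤ) : R) := by
  rw [Units.val_mul, Int.cast_mul, intUnits_cast_neg_one_pow]

end GLToolbox

/-! ## Mok's matrix `Φ_N` and the automorphism `α` of `GL_N` -/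

section Phi

variable (R : Type*) [CommRing R] (N : ℕ)

/-- **Mok's `Φ_N`** (1.0.2): the anti-diagonal matrix with alternating entries `1, -1, 1, …` read from the
top right corner (row `i` carries `(-1)^{i-1}` in column `N + 1 - i`; 0-indexed: `Φ i j = (-1)^i` if
`j = rev i`, else `0`). [cite: Mok2014, (1.0.2)] -/
def mokPhi : Matrix (Fin N) (Fin N) R :=
  Matrix.of fun i j => if j = i.rev then (-1 : R) ^ (i : ℕ) else 0

variable {R N}

/-- The entries of `Φ_N`. [cite: Mok2014, (1.0.2)] -/
@[simp]
theorem mokPhi_apply (i j : Fin N) : mokPhi R N i j = if j = i.rev then (-1 : R) ^ (i : ℕ) else 0 :=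
  rfl

/-- Sign bookkeeping along the anti-diagonal: `(-1)^{rev i} = (-1)^{N-1} (-1)^i` (`rev i = N - 1 - i`).
[folklore] -/
theorem neg_one_pow_val_rev (i : Fin N) :
    (-1 : R) ^ (N - ((i : ℕ) + 1)) = (-1) ^ (N + 1) * (-1) ^ (i : ℕ) := by
  rw [← pow_add]
  have h : N + 1 + (i : ℕ) = (N - (i + 1)) + 2 * ((i : ℕ) + 1) := by omega
  rw [h, pow_add, pow_mul, neg_one_sq, one_pow, mul_one]

/-- **`ᵗΦ_N = (-1)^{N-1} Φ_N`.** [cite: Mok2014, §2.1 (p. 6)] -/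
theorem transpose_mokPhi : (mokPhi R N)ᵀ = (-1 : R) ^ (N + 1) • mokPhi R N := by
  ext i j
  simp only [transpose_apply, mokPhi_apply, Matrix.smul_apply, smul_eq_mul]
  by_cases h : i = j.rev
  · subst h
    simp only [Fin.rev_rev, if_true, Fin.val_rev, neg_one_pow_val_rev, neg_one_pow_mul_neg_one_pow_mul_self]
  · have h' : ¬ j = i.rev := fun h' => h (by rw [h', Fin.rev_rev])
    simp [h, h']

/-- **`Φ_N² = (-1)^{N-1} I_N`.** [cite: Mok2014, §2.1 (p. 6)] -/
theorem mokPhi_mul_mokPhi : mokPhi R N * mokPhi R N = (-1 : R) ^ (N + 1) • (1 : Matrix (Fin N) (Fin N) R) := by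
  ext i k
  rw [mul_apply, Finset.sum_eq_single i.rev]
  · by_cases hk : k = i
    · subst hk
      have hk : (-1 : R) ^ (k : ℕ) * (-1) ^ (k : ℕ) = 1 := by
        simpa only [mul_one] using neg_one_pow_mul_neg_one_pow_mul_self (k : ℕ) (1 : R)
      simp only [mokPhi_apply, if_true, Fin.rev_rev, Fin.val_rev, neg_one_pow_val_rev, Matrix.smul_apply,
        one_apply_eq, smul_eq_mul, mul_one, mul_left_comm ((-1 : R) ^ (k : ℕ)), hk]
    · simp [hk, Ne.symm hk]
  · intro j _ hj
    simp [hj]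
  · intro h
    exact absurd (Finset.mem_univ _) h

/-- `Φ_N (Φ_N X) = (-1)^{N-1} X`. [folklore] -/
@[simp]
theorem mokPhi_mul_mokPhi_mul {m : Type*} (X : Matrix (Fin N) m R) :
    mokPhi R N * (mokPhi R N * X) = (-1 : R) ^ (N + 1) • X := by
  rw [← Matrix.mul_assoc, mokPhi_mul_mokPhi, smul_mul, Matrix.one_mul]

variable (R N) in
/-- `Φ_N` as an element of `GL_N(R)`, with inverse `(-1)^{N-1} Φ_N`. [cite: Mok2014, (1.0.2)] -/
def mokPhiGL : GL (Fin N) R where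
  val := mokPhi R N
  inv := (-1 : R) ^ (N + 1) • mokPhi R N
  val_inv := by
    have h : (-1 : R) ^ (N + 1) * (-1) ^ (N + 1) = 1 := by
      simpa only [mul_one] using neg_one_pow_mul_neg_one_pow_mul_self (N + 1) (1 : R)
    rw [Matrix.mul_smul, mokPhi_mul_mokPhi, smul_smul, h, one_smul]
  inv_val := by
    have h : (-1 : R) ^ (N + 1) * (-1) ^ (N + 1) = 1 := by
      simpa only [mul_one] using neg_one_pow_mul_neg_one_pow_mul_self (N + 1) (1 : R)
    rw [Matrix.smul_mul, mokPhi_mul_mokPhi, smul_smul, h, one_smul]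

/-- The matrix of `Φ_N ∈ GL_N`. [cite: Mok2014, (1.0.2)] -/
theorem coe_mokPhiGL : ((mokPhiGL R N : GL (Fin N) R) : Matrix (Fin N) (Fin N) R) = mokPhi R N :=
  rfl

/-- The matrix of `Φ_N⁻¹ = (-1)^{N-1} Φ_N`. [cite: Mok2014, §2.1 (p. 6)] -/
theorem coe_mokPhiGL_inv :
    (((mokPhiGL R N)⁻¹ : GL (Fin N) R) : Matrix (Fin N) (Fin N) R) = (-1 : R) ^ (N + 1) • mokPhi R N :=
  rfl

/-- `ᵗΦ_N = (-1)^{N-1} Φ_N` in `GL_N`. [cite: Mok2014, §2.1 (p. 6)] -/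
theorem transposeGL_mokPhiGL :
    transposeGL (mokPhiGL R N) = signGL ((-1) ^ (N + 1)) * mokPhiGL R N :=
  Units.ext (by simp [coe_transposeGL, coe_mokPhiGL, transpose_mokPhi, intUnits_cast_neg_one_pow])

/-- `Φ_N² = (-1)^{N-1}` in `GL_N`. [cite: Mok2014, §2.1 (p. 6)] -/
theorem mokPhiGL_mul_self : mokPhiGL R N * mokPhiGL R N = signGL ((-1) ^ (N + 1)) :=
  Units.ext (by simp [coe_mokPhiGL, mokPhi_mul_mokPhi, intUnits_cast_neg_one_pow])

/-- Matrix normal form: `Φ_N⁻¹ ↦ (-1)^{N-1} Φ_N`. [folklore] -/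
theorem coe_mokPhiGL_inv_eq_smul :
    (((mokPhiGL R N)⁻¹ : GL (Fin N) R) : Matrix (Fin N) (Fin N) R) =
      (-1 : R) ^ (N + 1) • ((mokPhiGL R N : GL (Fin N) R) : Matrix (Fin N) (Fin N) R) :=
  rfl

/-- Matrix normal form: `Φ_N (Φ_N X) = (-1)^{N-1} X`. [folklore] -/
theorem coe_mokPhiGL_mul_coe_mokPhiGL_mul {m : Type*} (X : Matrix (Fin N) m R) :
    ((mokPhiGL R N : GL (Fin N) R) : Matrix (Fin N) (Fin N) R) *
        (((mokPhiGL R N : GL (Fin N) R) : Matrix (Fin N) (Fin N) R) * X) = (-1 : R) ^ (N + 1) • X :=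
  mokPhi_mul_mokPhi_mul X

/-- Matrix normal form: `Φ_N Φ_N = (-1)^{N-1} I`. [folklore] -/
theorem coe_mokPhiGL_mul_coe_mokPhiGL :
    ((mokPhiGL R N : GL (Fin N) R) : Matrix (Fin N) (Fin N) R) *
        ((mokPhiGL R N : GL (Fin N) R) : Matrix (Fin N) (Fin N) R) = (-1 : R) ^ (N + 1) • 1 :=
  mokPhi_mul_mokPhi

/-- `Φ_N⁻¹ = (-1)^{N-1} Φ_N` in `GL_N`. [cite: Mok2014, §2.1 (p. 6)] -/
theorem mokPhiGL_inv : (mokPhiGL R N)⁻¹ = signGL ((-1) ^ (N + 1)) * mokPhiGL R N :=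
  inv_eq_of_mul_eq_one_right
    (by rw [← mul_assoc, ← signGL_comm, mul_assoc, mokPhiGL_mul_self, signGL_mul_self])

/-- `ᵗΦ_N = Φ_N⁻¹`. [folklore] -/
theorem transposeGL_mokPhiGL_eq_inv : transposeGL (mokPhiGL R N) = (mokPhiGL R N)⁻¹ := by
  rw [transposeGL_mokPhiGL, mokPhiGL_inv]

/-- **Mok's automorphism `α` of `Û(N) = GL_N`**: `α(g) = Φ_N ᵗg⁻¹ Φ_N⁻¹` (§2.1, p. 6), the action of
`W_F ∖ W_E` on `GL_N(ℂ)` in `ᴸU_{E/F}(N) = GL_N(ℂ) ⋊ W_F`. [cite: Mok2014, §2.1 (p. 6)] -/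
def mokAlpha (g : GL (Fin N) R) : GL (Fin N) R :=
  mokPhiGL R N * transposeGL g⁻¹ * (mokPhiGL R N)⁻¹

/-- Unfolding `α(g) = Φ_N ᵗg⁻¹ Φ_N⁻¹`. [cite: Mok2014, §2.1 (p. 6)] -/
theorem mokAlpha_def (g : GL (Fin N) R) :
    mokAlpha g = mokPhiGL R N * transposeGL g⁻¹ * (mokPhiGL R N)⁻¹ :=
  rfl

/-- `α` is multiplicative. [cite: Mok2014, §2.1 (p. 6)] -/
theorem mokAlpha_mul (g h : GL (Fin N) R) : mokAlpha (g * h) = mokAlpha g * mokAlpha h := by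
  simp only [mokAlpha_def, _root_.mul_inv_rev, transposeGL_mul]
  group

/-- `α(1) = 1`. [folklore] -/
@[simp]
theorem mokAlpha_one : mokAlpha (1 : GL (Fin N) R) = 1 := by
  simp [mokAlpha_def]

/-- `α(g⁻¹) = α(g)⁻¹`. [folklore] -/
theorem mokAlpha_inv (g : GL (Fin N) R) : mokAlpha g⁻¹ = (mokAlpha g)⁻¹ :=
  eq_inv_of_mul_eq_one_left (by rw [← mokAlpha_mul, inv_mul_cancel, mokAlpha_one])

/-- **`α` has order two** ("Thus `α` is of order two", §2.1 p. 6): `α(α(g)) = g`, by `ᵗΦ_N = (-1)^{N-1} Φ_N`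
and `Φ_N² = (-1)^{N-1}`. [cite: Mok2014, §2.1 (p. 6)] -/
theorem mokAlpha_mokAlpha (g : GL (Fin N) R) : mokAlpha (mokAlpha g) = g := by
  have h1 : mokAlpha (mokAlpha g) =
      mokPhiGL R N * (transposeGL (mokPhiGL R N))⁻¹ * g * transposeGL (mokPhiGL R N) * (mokPhiGL R N)⁻¹ := by
    simp only [mokAlpha_def, _root_.mul_inv_rev, transposeGL_mul, transposeGL_inv, transposeGL_transposeGL]
    group
  rw [h1, transposeGL_mokPhiGL_eq_inv, inv_inv, mokPhiGL_mul_self, signGL_comm, mul_assoc (g * _),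
    ← _root_.mul_inv_rev, mokPhiGL_mul_self, mul_assoc, mul_inv_cancel, mul_one]

/-- `α` as a multiplicative automorphism of `GL_N(R)`. [cite: Mok2014, §2.1 (p. 6)] -/
def mokAlphaAut : MulAut (GL (Fin N) R) where
  toFun := mokAlpha
  invFun := mokAlpha
  left_inv := mokAlpha_mokAlpha
  right_inv := mokAlpha_mokAlpha
  map_mul' := mokAlpha_mul

/-- Unfolding `mokAlphaAut`. [cite: Mok2014, §2.1 (p. 6)] -/
@[simp]
theorem mokAlphaAut_apply (g : GL (Fin N) R) : (mokAlphaAut g : GL (Fin N) R) = mokAlpha g :=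
  rfl

/-- `α² = 1` in `Aut(GL_N)` ("`α` is of order two"). [cite: Mok2014, §2.1 (p. 6)] -/
theorem mokAlphaAut_mul_self : (mokAlphaAut : MulAut (GL (Fin N) R)) * mokAlphaAut = 1 :=
  MulEquiv.ext fun g => mokAlpha_mokAlpha g

end Phi

/-! ## Index-two Weil data, conjugate self-dual characters, the parity condition (2.2.6) and the
parameters of `U(N)` -/

section Params

variable {R : Type*} [CommRing R] {n : Type*} [Fintype n] [DecidableEq n]
variable {W : Type*} [Group W] {s : W →* ℤˣ} {wc : W}

/-- `w_c² ∈ W_E = ker s` as soon as `s(w_c) = -1`. [cite: Mok2014, §2.1 (2.1.8)] -/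
theorem mul_self_mem_ker_of_eq_neg_one (hwc : s wc = -1) : wc * wc ∈ s.ker := by
  rw [MonoidHom.mem_ker, map_mul, hwc, Int.units_mul_self]

/-- The element `w_c²` of `W_E = ker s`. [cite: Mok2014, §2.1 (2.1.8)] -/
def wcSq (s : W →* ℤˣ) (wc : W) (hwc : s wc = -1) : s.ker :=
  ⟨wc * wc, mul_self_mem_ker_of_eq_neg_one hwc⟩

/-- `w_c²` as an element of `W`. [folklore] -/
@[simp]
theorem coe_wcSq (hwc : s wc = -1) : ((wcSq s wc hwc : s.ker) : W) = wc * wc :=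
  rfl

/-- Conjugation `σ ↦ w_c⁻¹ σ w_c` of the normal subgroup `W_E = ker s` (Mathlib's `MulAut.conjNormal`
at `w_c⁻¹`). [cite: Mok2014, (2.2.3)] -/
abbrev kerConj (s : W →* ℤˣ) (wc : W) : s.ker ≃* s.ker :=
  MulAut.conjNormal (wc⁻¹ : W)

/-- `kerConj s w_c σ = w_c⁻¹ σ w_c` in `W`. [cite: Mok2014, (2.2.3)] -/
@[simp]
theorem coe_kerConj_apply (σ : s.ker) : ((kerConj s wc σ : s.ker) : W) = wc⁻¹ * σ * wc := by
  rw [kerConj, MulAut.conjNormal_apply, inv_inv]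

/-- **`ρ^c`** (Mok, (2.2.3)): `ρ^c(σ) := ρ(w_c⁻¹ σ w_c)` for a homomorphism `ρ` on `W_E` (resp. `L_E`).
[cite: Mok2014, (2.2.3)] -/
def conjParam (s : W →* ℤˣ) (wc : W) {G : Type*} [Monoid G] (ρ : s.ker →* G) : s.ker →* G :=
  ρ.comp (kerConj s wc).toMonoidHom

/-- Unfolding `ρ^c(σ) = ρ(w_c⁻¹ σ w_c)`. [cite: Mok2014, (2.2.3)] -/
@[simp]
theorem conjParam_apply {G : Type*} [Monoid G] (ρ : s.ker →* G) (σ : s.ker) :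
    conjParam s wc ρ σ = ρ (kerConj s wc σ) :=
  rfl

/-- **Conjugate self-dual characters of sign `κ`** (Mok, (2.1.7)–(2.1.8)): a character `χ = χ_κ` of
`W_E` with `χ(w_c σ w_c⁻¹) = χ(σ)⁻¹` for `σ ∈ W_E` — equivalently (substituting `σ ↦ w_c⁻¹ σ w_c`)
`χ(w_c⁻¹ σ w_c) χ(σ) = 1` — and `χ(w_c²) = κ`; these are the members of `𝒵_E^κ` viewed on `W_E` by class
field theory ("`χ_κ(w_c σ w_c⁻¹) = χ_κ(σ)⁻¹` for `σ ∈ W_E`", "`χ_κ(w_c²) = κ`"). [cite: Mok2014, (2.1.7)–(2.1.8)] -/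
structure IsConjSelfDualCharOfSign (s : W →* ℤˣ) (wc : W) (hwc : s wc = -1) (χ : s.ker →* Rˣ)
    (κ : ℤˣ) : Prop where
  /-- (2.1.7): `χ(w_c⁻¹ σ w_c) χ(σ) = 1`. -/
  conj_mul : ∀ σ : s.ker, χ (kerConj s wc σ) * χ σ = 1
  /-- (2.1.8): `χ(w_c²) = κ`. -/
  map_wcSq : χ (wcSq s wc hwc) = signUnit R κ

/-- The trivial character has sign `+1` (`χ_+ = 1 ∈ 𝒵_E^+`, "for `κ = +1` it is of course natural to just
take `χ_+ = 1`"). [cite: Mok2014, §2.1 (p. 7)] -/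
theorem isConjSelfDualCharOfSign_one (hwc : s wc = -1) :
    IsConjSelfDualCharOfSign (R := R) s wc hwc 1 1 where
  conj_mul σ := by simp
  map_wcSq := by simp [map_one]

/-- A conjugate self-dual character of sign `κ` has inverse of sign `κ` (`κ⁻¹ = κ`). [folklore] -/
theorem IsConjSelfDualCharOfSign.inv {hwc : s wc = -1} {χ : s.ker →* Rˣ} {κ : ℤˣ}
    (h : IsConjSelfDualCharOfSign s wc hwc χ κ) : IsConjSelfDualCharOfSign s wc hwc χ⁻¹ κ where
  conj_mul σ := by rw [MonoidHom.inv_apply, MonoidHom.inv_apply, ← mul_inv, h.conj_mul, inv_one]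
  map_wcSq := by rw [MonoidHom.inv_apply, h.map_wcSq, ← map_inv, Int.units_inv_eq_self]

/-- **The twist `ρ ⊗ χ`** of a parameter `ρ : W_E → GL_n` by a character `χ` (scalar matrices are
central). [cite: Mok2014, proof of Lemma 2.2.1] -/
def twistParam (ρ : s.ker →* GL n R) (χ : s.ker →* Rˣ) : s.ker →* GL n R where
  toFun σ := scalarGL (χ σ) * ρ σ
  map_one' := by simp
  map_mul' σ τ := by
    simp only [map_mul]
    calc scalarGL (χ σ) * scalarGL (χ τ) * (ρ σ * ρ τ)
        = scalarGL (χ σ) * (scalarGL (χ τ) * ρ σ) * ρ τ := by group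
      _ = scalarGL (χ σ) * (ρ σ * scalarGL (χ τ)) * ρ τ := by rw [scalarGL_comm (χ τ) (ρ σ)]
      _ = scalarGL (χ σ) * ρ σ * (scalarGL (χ τ) * ρ τ) := by group

/-- Unfolding `(ρ ⊗ χ)(σ) = χ(σ) ρ(σ)`. [folklore] -/
@[simp]
theorem twistParam_apply (ρ : s.ker →* GL n R) (χ : s.ker →* Rˣ) (σ : s.ker) :
    twistParam ρ χ σ = scalarGL (χ σ) * ρ σ :=
  rfl

/-- `(ρ ⊗ χ⁻¹) ⊗ χ = ρ`. [folklore] -/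
theorem twistParam_twistParam_inv (ρ : s.ker →* GL n R) (χ : s.ker →* Rˣ) :
    twistParam (twistParam ρ χ⁻¹) χ = ρ := by
  ext σ : 1
  simp [← mul_assoc]

/-- `(ρ ⊗ χ) ⊗ χ⁻¹ = ρ`. [folklore] -/
theorem twistParam_inv_twistParam (ρ : s.ker →* GL n R) (χ : s.ker →* Rˣ) :
    twistParam (twistParam ρ χ) χ⁻¹ = ρ := by
  ext σ : 1
  simp [← mul_assoc]

/-- **Conjugate self-duality of parity `η`, matrix form** (Mok, (2.2.5)–(2.2.6)): a parameter
`ρ : W_E → GL_n` is conjugate self-dual of parity `η ∈ {±1}` if there is `A ∈ GL_n` (a non-degenerate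
bilinear form `B(x, y) = ᵗx A y` with `B(ρ^c(σ) x, ρ(σ) y) = B(x, y)` and `B(x, y) = η B(y, ρ(w_c²) x)`) such
that `ᵗρ^c(σ) A ρ(σ) = A` for all `σ ∈ W_E` and `ᵗA = η · A · ρ(w_c²)`.  Parity `+1`: conjugate orthogonal;
`-1`: conjugate symplectic (Gan–Gross–Prasad, §3). [cite: Mok2014, (2.2.5)–(2.2.6)]
[cite: GanGrossPrasad2012, §3] -/
def IsConjSelfDualOfParityGL (s : W →* ℤˣ) (wc : W) (hwc : s wc = -1) (ρ : s.ker →* GL n R)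
    (η : ℤˣ) : Prop :=
  ∃ A : GL n R, (∀ σ : s.ker, transposeGL (conjParam s wc ρ σ) * A * ρ σ = A) ∧
    transposeGL A = signGL η * A * ρ (wcSq s wc hwc)

/-- **Parameters of `U_{E/F}(N)` as data on `W_E`.**  In `ᴸU_{E/F}(N) = GL_N ⋊ W_F` (`W_E` acting
trivially, `W_F ∖ W_E` through `α`), a homomorphism `φ : W_F → ᴸU(N)` over `W_F` is the pair
`ρ := φ|_{W_E} : W_E → GL_N` (a homomorphism) and `C ∈ GL_N` with `φ(w_c) = C ⋊ w_c`, subject to the two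
relations coming from `φ(w_c²) = φ(w_c)²` and `φ(w_c⁻¹ σ w_c) = φ(w_c)⁻¹ φ(σ) φ(w_c)`:
`ρ(w_c²) = C α(C)` and `ρ^c(σ) = α(C⁻¹ ρ(σ) C)` (`(C ⋊ w_c)² = C α(C) ⋊ w_c²`,
`(C ⋊ w_c)⁻¹ (ρ(σ) ⋊ σ) (C ⋊ w_c) = α(C⁻¹ ρ(σ) C) ⋊ w_c⁻¹ σ w_c`; `IsLHom.isUnitaryLParamData` below
derives them from an actual homomorphism into the semidirect product).  This is the datum
"`ρ = φ|_{L_E}`, `φ(w_c) = C ⋊ w_c`" of Mok's proof of Lemma 2.2.1. [cite: Mok2014, proof of Lemma 2.2.1] -/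
structure IsUnitaryLParamData (s : W →* ℤˣ) (wc : W) (hwc : s wc = -1) {N : ℕ}
    (ρ : s.ker →* GL (Fin N) R) (C : GL (Fin N) R) : Prop where
  /-- `φ(w_c²) = φ(w_c)²`: `ρ(w_c²) = C α(C)`. -/
  map_wcSq : ρ (wcSq s wc hwc) = C * mokAlpha C
  /-- `φ(w_c⁻¹ σ w_c) = φ(w_c)⁻¹ φ(σ) φ(w_c)`: `ρ^c(σ) = α(C⁻¹ ρ(σ) C)`. -/
  conjParam_eq : ∀ σ : s.ker, conjParam s wc ρ σ = mokAlpha (C⁻¹ * ρ σ * C)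

/-- From `ᵗx A y = A` in `GL_n`: `x = ᵗ(A y⁻¹ A⁻¹)`. [folklore] -/
theorem eq_transposeGL_of_transposeGL_mul_mul_eq {x A y : GL n R} (h : transposeGL x * A * y = A) :
    x = transposeGL (A * y⁻¹ * A⁻¹) := by
  have h1 : transposeGL x = A * y⁻¹ * A⁻¹ := by
    calc transposeGL x = transposeGL x * A * y * y⁻¹ * A⁻¹ := by group
      _ = A * y⁻¹ * A⁻¹ := by rw [h]
  rw [← transposeGL_transposeGL x, h1]

/-- From `ᵗx A y = A` in `GL_n`: `ᵗx = A y⁻¹ A⁻¹`. [folklore] -/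
theorem transposeGL_eq_of_transposeGL_mul_mul_eq {x A y : GL n R} (h : transposeGL x * A * y = A) :
    transposeGL x = A * y⁻¹ * A⁻¹ := by
  calc transposeGL x = transposeGL x * A * y * y⁻¹ * A⁻¹ := by group
    _ = A * y⁻¹ * A⁻¹ := by rw [h]

/-- **Parity is a property of the equivalence class** ("two `L`-parameters are equivalent if they are
conjugate by `Ĝ`", §2.2): if `ρ = g ρ₁ g⁻¹` and `ρ` is conjugate self-dual of parity `η` with form `A`, then so
is `ρ₁`, with form `ᵗg A g`. [cite: Mok2014, §2.2 (p. 8)] -/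
theorem IsConjSelfDualOfParityGL.of_eq_conj {hwc : s wc = -1} {ρ ρ₁ : s.ker →* GL n R} {η : ℤˣ}
    (h : IsConjSelfDualOfParityGL s wc hwc ρ η) (g : GL n R) (hg : ∀ σ, ρ σ = g * ρ₁ σ * g⁻¹) :
    IsConjSelfDualOfParityGL s wc hwc ρ₁ η := by
  obtain ⟨A, hinv, hsgn⟩ := h
  have hg' : ∀ σ, ρ₁ σ = g⁻¹ * ρ σ * g := fun σ => by rw [hg σ]; group
  refine ⟨transposeGL g * A * g, fun σ => ?_, ?_⟩
  · have h1 := transposeGL_eq_of_transposeGL_mul_mul_eq (hinv σ)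
    simp only [conjParam_apply] at h1 ⊢
    simp only [hg', transposeGL_mul, transposeGL_inv, h1]
    group
  · simp only [hg', transposeGL_mul, transposeGL_transposeGL, hsgn]
    apply Units.ext
    simp only [Units.val_mul, coe_signGL, mul_assoc, smul_mul_assoc, mul_smul_comm, one_mul,
      Units.mul_inv_cancel_left]

end Params

/-! ## Lemma 2.2.1: the image of `ξ_{χ_κ,*}` is the set of conjugate self-dual parameters of parity
`(-1)^{N-1} κ` -/

section Lemma221

variable {R : Type*} [CommRing R] {N : ℕ}
variable {W : Type*} [Group W] {s : W →* ℤˣ} {wc : W} {hwc : s wc = -1}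

/-- **Mok, Lemma 2.2.1, the direction `⊆`** (proof, (2.2.7)–(2.2.8)): if `(ρ, C)` is a parameter of
`U_{E/F}(N)` (`ρ = φ|_{W_E}`, `φ(w_c) = C ⋊ w_c`) and `χ = χ_κ ∈ 𝒵_E^κ`, then the parameter
`ρ' = ρ ⊗ χ_κ` of `GL_N(E)` attached to `ξ_{χ_κ} ∘ φ` is conjugate self-dual of parity `(-1)^{N-1} κ`, with
the form `A := Φ_N C⁻¹`: "by direct computation (using `ᵗΦ_N = (-1)^{N-1} Φ_N`) we have
`ᵗA = (-1)^{N-1} A · ρ(w_c²)`" (2.2.7), "`ᵗρ^c(σ) A ρ(σ) = A`" (2.2.8), and `χ_κ(w_c²) = κ` turns (2.2.7) into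
`ᵗA = (-1)^{N-1} κ A · ρ'(w_c²)` while (2.1.7) keeps (2.2.8) for `ρ'`. [cite: Mok2014, Lemma 2.2.1, (2.2.7)–(2.2.8)]
[cite: GanGrossPrasad2012, Thm. 8.1] -/
theorem IsUnitaryLParamData.isConjSelfDualOfParityGL_twistParam {ρ : s.ker →* GL (Fin N) R}
    {C : GL (Fin N) R} (h : IsUnitaryLParamData s wc hwc ρ C) {χ : s.ker →* Rˣ} {κ : ℤˣ}
    (hχ : IsConjSelfDualCharOfSign s wc hwc χ κ) :
    IsConjSelfDualOfParityGL s wc hwc (twistParam ρ χ) ((-1) ^ (N + 1) * κ) := by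
  refine ⟨mokPhiGL R N * C⁻¹, fun σ => ?_, ?_⟩
  · -- (2.2.8), twisted by `χ`
    have hc := h.conjParam_eq σ
    have hχ' : χ (kerConj s wc σ) = (χ σ)⁻¹ := eq_inv_of_mul_eq_one_left (hχ.conj_mul σ)
    simp only [conjParam_apply] at hc ⊢
    simp only [twistParam_apply, hc, hχ', mokAlpha_def, transposeGL_mul, transposeGL_inv,
      transposeGL_transposeGL, transposeGL_scalarGL, transposeGL_mokPhiGL_eq_inv, inv_inv, _root_.mul_inv_rev]
    have hεε : (-1 : R) ^ (N + 1) * (-1) ^ (N + 1) = 1 := by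
      simpa only [mul_one] using neg_one_pow_mul_neg_one_pow_mul_self (N + 1) (1 : R)
    apply Units.ext
    simp only [Units.val_mul, coe_scalarGL, coe_mokPhiGL_inv_eq_smul, mul_assoc, smul_mul_assoc,
      mul_smul_comm, smul_smul, one_mul, mul_one, Units.mul_inv_cancel_left, Units.inv_mul, Units.mul_inv,
      coe_mokPhiGL_mul_coe_mokPhiGL_mul, one_smul, hεε]
  · -- (2.2.7), twisted by `χ`
    simp only [twistParam_apply, h.map_wcSq, hχ.map_wcSq, mokAlpha_def, transposeGL_mul, transposeGL_inv,
      transposeGL_mokPhiGL_eq_inv, map_mul]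
    have hεε : (-1 : R) ^ (N + 1) * (-1) ^ (N + 1) = 1 := by
      simpa only [mul_one] using neg_one_pow_mul_neg_one_pow_mul_self (N + 1) (1 : R)
    apply Units.ext
    simp only [Units.val_mul, coe_scalarGL, coe_signGL, coe_signUnit, coe_mokPhiGL_inv_eq_smul, mul_assoc,
      smul_mul_assoc, mul_smul_comm, smul_smul, one_mul, mul_one, Units.inv_mul_cancel_left,
      coe_mokPhiGL_mul_coe_mokPhiGL_mul, one_smul, mul_comm, mul_left_comm, intUnits_cast_mul_self,
      hεε, intUnits_cast_neg_one_pow]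

/-- **Mok, Lemma 2.2.1, the direction `⊇`** (proof, second half): if `ρ' : W_E → GL_N` is conjugate
self-dual of parity `η = (-1)^{N-1} κ` with form `A`, and `χ_κ ∈ 𝒵_E^κ`, then `ρ := ρ' ⊗ χ_κ⁻¹` together with
`C := A⁻¹ Φ_N` ("`C := (-1)^{N-1} A⁻¹ Φ_N⁻¹ = A⁻¹ Φ_N`") is a parameter of `U_{E/F}(N)`:
`φ(σ) = (ρ' ⊗ χ_κ⁻¹)(σ) ⋊ σ`, `φ(w_c) = C ⋊ w_c`, and `ρ' = ρ ⊗ χ_κ` is (the `GL_N(E)`-parameter attached to)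
`ξ_{χ_κ} ∘ φ` (`twistParam_twistParam_inv`).  The two relations of `IsUnitaryLParamData` are read off from
Mok's `φ''(w_c) = (η A⁻¹, ᵗA) ⋊ w_c` and `φ''(σ) = (ρ'(σ), ᵗρ'(σ)⁻¹) ⋊ σ`. [cite: Mok2014, Lemma 2.2.1 (proof, p. 9)]
[cite: GanGrossPrasad2012, Thm. 8.1] -/
theorem IsConjSelfDualOfParityGL.exists_isUnitaryLParamData_twistParam_inv {ρ' : s.ker →* GL (Fin N) R}
    {κ : ℤˣ} (h : IsConjSelfDualOfParityGL s wc hwc ρ' ((-1) ^ (N + 1) * κ)) {χ : s.ker →* Rˣ}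
    (hχ : IsConjSelfDualCharOfSign s wc hwc χ κ) :
    ∃ C : GL (Fin N) R, IsUnitaryLParamData s wc hwc (twistParam ρ' χ⁻¹) C := by
  obtain ⟨A, hinv, hsgn⟩ := h
  refine ⟨A⁻¹ * mokPhiGL R N, ?_, fun σ => ?_⟩
  · -- `ρ(w_c²) = C α(C)`
    simp only [twistParam_apply, MonoidHom.inv_apply, hχ.map_wcSq, signUnit_inv, mokAlpha_def,
      transposeGL_mul, transposeGL_inv, transposeGL_mokPhiGL_eq_inv, inv_inv, _root_.mul_inv_rev, hsgn,
      map_mul]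
    have hεε : (-1 : R) ^ (N + 1) * (-1) ^ (N + 1) = 1 := by
      simpa only [mul_one] using neg_one_pow_mul_neg_one_pow_mul_self (N + 1) (1 : R)
    apply Units.ext
    simp only [Units.val_mul, coe_scalarGL, coe_signGL, coe_signUnit, coe_mokPhiGL_inv_eq_smul, mul_assoc,
      smul_mul_assoc, mul_smul_comm, smul_smul, one_mul, mul_one, Units.inv_mul_cancel_left,
      coe_mokPhiGL_mul_coe_mokPhiGL_mul, coe_mokPhiGL_mul_coe_mokPhiGL, one_smul, mul_comm, mul_left_comm,
      hεε, intUnits_cast_neg_one_pow]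
  · -- `ρ^c(σ) = α(C⁻¹ ρ(σ) C)`
    have hc := eq_transposeGL_of_transposeGL_mul_mul_eq (hinv σ)
    have hχ' : χ (kerConj s wc σ) = (χ σ)⁻¹ := eq_inv_of_mul_eq_one_left (hχ.conj_mul σ)
    simp only [conjParam_apply] at hc ⊢
    simp only [twistParam_apply, MonoidHom.inv_apply, hc, hχ', mokAlpha_def, transposeGL_mul,
      transposeGL_inv, transposeGL_scalarGL, transposeGL_mokPhiGL_eq_inv, inv_inv, _root_.mul_inv_rev,
      scalarGL_inv']
    have hεε : (-1 : R) ^ (N + 1) * (-1) ^ (N + 1) = 1 := by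
      simpa only [mul_one] using neg_one_pow_mul_neg_one_pow_mul_self (N + 1) (1 : R)
    apply Units.ext
    simp only [Units.val_mul, coe_scalarGL, coe_mokPhiGL_inv_eq_smul, mul_assoc, smul_mul_assoc,
      mul_smul_comm, smul_smul, one_mul, mul_one, coe_mokPhiGL_mul_coe_mokPhiGL_mul,
      coe_mokPhiGL_mul_coe_mokPhiGL, one_smul, mul_comm, hεε,
      neg_one_pow_mul_neg_one_pow_mul_self]

/-- **Lemma 2.2.1 as an equivalence on parameters of `W_E`**: `ρ' : W_E → GL_N` is conjugate self-dual of
parity `(-1)^{N-1} κ` iff `ρ' = ρ ⊗ χ_κ` for a parameter `(ρ, C)` of `U_{E/F}(N)` — "the image of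
`ξ_{χ_κ,*} : Φ(U_{E/F}(N)) → Φ(G_{E/F}(N)) ≅ Φ(GL_N(E))` is given by the set of parameters in `Φ(GL_N(E))`
that are conjugate self-dual with parity `η = (-1)^{N-1} κ`" (the identification `Φ(G(N)) ≅ Φ(GL_N(E))`,
under which `ξ_{χ_κ} ∘ φ` corresponds to `φ|_{L_E} ⊗ χ_κ`, is [R] p. 48 / (2.2.2) and is used here, as in
the source, as the definition of the left-hand side). [cite: Mok2014, Lemma 2.2.1]
[cite: GanGrossPrasad2012, Thm. 8.1] -/
theorem isConjSelfDualOfParityGL_iff_exists_isUnitaryLParamData (ρ' : s.ker →* GL (Fin N) R) (κ : ℤˣ)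
    {χ : s.ker →* Rˣ} (hχ : IsConjSelfDualCharOfSign s wc hwc χ κ) :
    IsConjSelfDualOfParityGL s wc hwc ρ' ((-1) ^ (N + 1) * κ) ↔
      ∃ (ρ : s.ker →* GL (Fin N) R) (C : GL (Fin N) R),
        IsUnitaryLParamData s wc hwc ρ C ∧ ρ' = twistParam ρ χ := by
  constructor
  · intro h
    obtain ⟨C, hC⟩ := h.exists_isUnitaryLParamData_twistParam_inv hχ
    exact ⟨_, C, hC, (twistParam_twistParam_inv ρ' χ).symm⟩
  · rintro ⟨ρ, C, hρ, rfl⟩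
    exact hρ.isConjSelfDualOfParityGL_twistParam hχ

end Lemma221

/-! ## The `L`-group `ᴸU_{E/F}(N) = GL_N ⋊ W_F` and its `L`-homomorphisms -/

section LGroup

variable {R : Type*} [CommRing R] {N : ℕ}
variable {W : Type*} [Group W] {s : W →* ℤˣ} {wc : W}

/-- An involution `α` of a group (`α² = 1`) defines an action of `ℤˣ = {±1}` (`-1 ↦ α`). [folklore] -/
def involutionAct {G : Type*} [Group G] (α : MulAut G) (hα : α * α = 1) : ℤˣ →* MulAut G where
  toFun u := if u = 1 then 1 else α
  map_one' := if_pos rfl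
  map_mul' u v := by
    have hne : (-1 : ℤˣ) ≠ 1 := by decide
    rcases Int.units_eq_one_or u with rfl | rfl <;> rcases Int.units_eq_one_or v with rfl | rfl
    · rw [one_mul, if_pos rfl, one_mul]
    · rw [one_mul, if_neg hne, if_pos rfl, one_mul]
    · rw [mul_one, if_neg hne, if_pos rfl, mul_one]
    · rw [Int.units_mul_self, if_pos rfl, if_neg hne, hα]

/-- Unfolding `involutionAct`: `1 ↦ 1`, `-1 ↦ α`. [folklore] -/
theorem involutionAct_apply {G : Type*} [Group G] (α : MulAut G) (hα : α * α = 1) (u : ℤˣ) :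
    involutionAct α hα u = if u = 1 then 1 else α :=
  rfl

variable (R N s) in
/-- **The `L`-action defining `ᴸU_{E/F}(N)`**: `W_F` acts on `Û(N) = GL_N` through `W_F / W_E = {±1}`,
trivially on `W_E = ker s` and by `α` off it ("if `w_c ∈ W_F ∖ W_E`, then `w_c` acts as the
automorphism `α`"). [cite: Mok2014, §2.1 (p. 6)] -/
def lGroupUAct : W →* MulAut (GL (Fin N) R) :=
  (involutionAct mokAlphaAut mokAlphaAut_mul_self).comp s

/-- The `L`-action: `w · g = g` if `s(w) = 1`, `α(g)` otherwise. [cite: Mok2014, §2.1 (p. 6)] -/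
theorem lGroupUAct_apply (w : W) (g : GL (Fin N) R) :
    lGroupUAct R N s w g = if s w = 1 then g else mokAlpha g := by
  simp only [lGroupUAct, MonoidHom.coe_comp, Function.comp_apply, involutionAct_apply]
  split_ifs <;> rfl

/-- `W_E` acts trivially. [cite: Mok2014, §2.1 (p. 6)] -/
theorem lGroupUAct_apply_of_eq_one {w : W} (hw : s w = 1) (g : GL (Fin N) R) : lGroupUAct R N s w g = g := by
  rw [lGroupUAct_apply, if_pos hw]

/-- `W_F ∖ W_E` acts by `α`. [cite: Mok2014, §2.1 (p. 6)] -/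
theorem lGroupUAct_apply_of_eq_neg_one {w : W} (hw : s w = -1) (g : GL (Fin N) R) :
    lGroupUAct R N s w g = mokAlpha g := by
  rw [lGroupUAct_apply, if_neg (by rw [hw]; decide)]

variable (R N s) in
/-- **The `L`-group `ᴸU_{E/F}(N) = Û(N) ⋊ W_F = GL_N ⋊ W_F`** over the index-two datum `s : W_F → {±1}`
(kernel `W_E`), Mok §2.1: "`ᴸU_{E/F}(N) = GL_N(ℂ) ⋊ W_F` with the action of `W_F` on `GL_N(ℂ)` factors through
`Gal(E/F)`, and if `w_c ∈ W_F ∖ W_E`, then `w_c` acts as the automorphism `α`". [cite: Mok2014, §2.1 (p. 6)] -/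
abbrev LGroupU : Type _ :=
  GL (Fin N) R ⋊[lGroupUAct R N s] W

/-- An **`L`-homomorphism** `φ : W_F → ᴸU(N)`: a homomorphism over `W_F` (`pr_{W_F} ∘ φ = id`), the shape
of an `L`-parameter `φ : L_F → ᴸU(N)` (admissibility conditions aside). [cite: Mok2014, §2.2 (p. 8)] -/
def IsLHom (φ : W →* LGroupU R N s) : Prop :=
  ∀ w : W, (φ w).right = w

/-- The restriction `ρ = φ|_{W_E} : W_E → GL_N` of an `L`-homomorphism (`W_E` acts trivially, so the first
coordinate is multiplicative on `W_E`). [cite: Mok2014, proof of Lemma 2.2.1] -/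
def IsLHom.restrict {φ : W →* LGroupU R N s} (hφ : IsLHom φ) : s.ker →* GL (Fin N) R where
  toFun σ := (φ σ).left
  map_one' := by simp
  map_mul' σ τ := by
    have hσ : s (σ : W) = 1 := σ.2
    simp only [Subgroup.coe_mul, map_mul, SemidirectProduct.mul_left, hφ (σ : W),
      lGroupUAct_apply_of_eq_one hσ]

/-- Unfolding `φ|_{W_E}(σ) = φ(σ).left`. [cite: Mok2014, proof of Lemma 2.2.1] -/
@[simp]
theorem IsLHom.restrict_apply {φ : W →* LGroupU R N s} (hφ : IsLHom φ) (σ : s.ker) :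
    hφ.restrict σ = (φ σ).left :=
  rfl

/-- **From an `L`-homomorphism to the data `(ρ, C)`**: for `φ : W_F → ᴸU(N)` over `W_F` and
`w_c ∈ W_F ∖ W_E`, the pair `ρ := φ|_{W_E}`, `C := φ(w_c).left` (`φ(w_c) = C ⋊ w_c`) satisfies
`ρ(w_c²) = C α(C)` (from `φ(w_c²) = φ(w_c)²`) and `ρ^c(σ) = α(C⁻¹ ρ(σ) C)` (from
`φ(w_c⁻¹ σ w_c) = φ(w_c)⁻¹ φ(σ) φ(w_c)`) — Mok's "`ρ(w_c²) ⋊ w_c² = φ(w_c²) = φ(w_c)²`" and "using the identity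
`φ(w_c⁻¹ σ w_c) = φ(w_c)⁻¹ φ(σ) φ(w_c)`". [cite: Mok2014, proof of Lemma 2.2.1, (2.2.7)–(2.2.8)] -/
theorem IsLHom.isUnitaryLParamData {φ : W →* LGroupU R N s} (hφ : IsLHom φ) (hwc : s wc = -1) :
    IsUnitaryLParamData s wc hwc hφ.restrict (φ wc).left where
  map_wcSq := by
    show (φ (wc * wc)).left = _
    rw [map_mul, SemidirectProduct.mul_left, hφ wc, lGroupUAct_apply_of_eq_neg_one hwc]
  conjParam_eq σ := by
    have hσ : s (σ : W) = 1 := σ.2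
    have h1 : s wc⁻¹ = -1 := by rw [map_inv, hwc]; decide
    have h2 : s (wc⁻¹ * σ) = -1 := by rw [map_mul, h1, hσ, mul_one]
    rw [conjParam_apply, IsLHom.restrict_apply, IsLHom.restrict_apply, coe_kerConj_apply, map_mul, map_mul,
      map_inv, SemidirectProduct.mul_left, SemidirectProduct.mul_left, SemidirectProduct.inv_left,
      SemidirectProduct.mul_right, SemidirectProduct.inv_right, hφ wc, hφ (σ : W),
      lGroupUAct_apply_of_eq_neg_one h1, lGroupUAct_apply_of_eq_neg_one h1,
      lGroupUAct_apply_of_eq_neg_one h2, ← mokAlpha_mul, ← mokAlpha_mul]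

/-- Hence (Lemma 2.2.1, `⊆`, for an actual `L`-homomorphism): **for `φ : W_F → ᴸU(N)` over `W_F` and
`χ_κ ∈ 𝒵_E^κ`, the parameter `φ|_{W_E} ⊗ χ_κ` of `GL_N(E)` attached to `ξ_{χ_κ} ∘ φ` is conjugate self-dual
of parity `(-1)^{N-1} κ`.** [cite: Mok2014, Lemma 2.2.1] [cite: GanGrossPrasad2012, Thm. 8.1] -/
theorem IsLHom.isConjSelfDualOfParityGL_twistParam {φ : W →* LGroupU R N s} (hφ : IsLHom φ)
    (hwc : s wc = -1) {χ : s.ker →* Rˣ} {κ : ℤˣ} (hχ : IsConjSelfDualCharOfSign s wc hwc χ κ) :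
    IsConjSelfDualOfParityGL s wc hwc (twistParam hφ.restrict χ) ((-1) ^ (N + 1) * κ) :=
  (hφ.isUnitaryLParamData hwc).isConjSelfDualOfParityGL_twistParam hχ

/-- In particular (`κ = +1`, `χ_+ = 1`, the **standard base change**): `φ|_{W_E}` itself is conjugate
self-dual of parity `(-1)^{N-1}`. [cite: Mok2014, Lemma 2.2.1] -/
theorem IsLHom.isConjSelfDualOfParityGL_restrict {φ : W →* LGroupU R N s} (hφ : IsLHom φ)
    (hwc : s wc = -1) : IsConjSelfDualOfParityGL s wc hwc hφ.restrict ((-1) ^ (N + 1)) := by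
  have h := hφ.isConjSelfDualOfParityGL_twistParam hwc (isConjSelfDualCharOfSign_one (R := R) hwc)
  rw [mul_one] at h
  convert h using 2
  ext σ : 1
  simp

end LGroup

/-! ## The archimedean instance: `W_ℝ ⊃ W_ℂ = ℂˣ`, `w_c = j` -/

section WeilReal

/-- **The Weil group of `ℝ`**: `W_ℝ = ℂˣ ⊔ ℂˣ j` with `j z j⁻¹ = z̄` and `j² = -1` (the non-split extension
of `Gal(ℂ/ℝ)` by `W_ℂ = ℂˣ`).  An element `z · j^e`, `e ∈ {0, 1}`, is stored as the pair `(z, e)`;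
multiplication `(z₁ j^{e₁})(z₂ j^{e₂}) = z₁ · j^{e₁} z₂ j^{-e₁} · j^{e₁ + e₂}` with `j z j⁻¹ = z̄`, `j² = -1`.
(Tate, *Number theoretic background*, Corvallis 1979, (1.4.3); here `L_F = W_F` for `F` archimedean, Mok
(2.2.1).) [cite: Mok2014, (2.2.1)] -/
@[ext]
structure WeilGroupReal : Type where
  /-- the `ℂˣ`-coordinate `z` of `z · j^e` -/
  z : ℂˣ
  /-- the exponent `e ∈ {0, 1}` of `j` in `z · j^e` -/
  e : Bool

/-- `z̄̄ = z` on `ℂˣ`. [folklore] -/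
@[simp]
theorem weilConj_weilConj (z : ℂˣ) : weilConj (weilConj z) = z := by
  ext; simp

/-- `(-z)‾ = -z̄` on `ℂˣ`. [folklore] -/
@[simp]
theorem weilConj_neg (z : ℂˣ) : weilConj (-z) = -weilConj z := by
  ext; simp

namespace WeilGroupReal

/-- Multiplication `(z₁ j^{e₁})(z₂ j^{e₂}) = z₁ (j^{e₁} z₂ j^{-e₁}) (j^{e₁} j^{e₂})`, `j z j⁻¹ = z̄`, `j² = -1`.
[cite: Mok2014, (2.2.1)] -/
instance : Mul WeilGroupReal :=
  ⟨fun a b => ⟨a.z * (if a.e then weilConj b.z else b.z) * (if (a.e && b.e) then -1 else 1), xor a.e b.e⟩⟩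

/-- The unit `1 = 1 · j⁰`. [folklore] -/
instance : One WeilGroupReal :=
  ⟨⟨1, false⟩⟩

/-- Inversion: `(z)⁻¹ = z⁻¹`, `(z j)⁻¹ = -z̄⁻¹ j` (as `(z j)(w j) = -z w̄`). [folklore] -/
instance : Inv WeilGroupReal :=
  ⟨fun a => ⟨if a.e then -(weilConj a.z)⁻¹ else a.z⁻¹, a.e⟩⟩

/-- The `ℂˣ`-coordinate of a product. [cite: Mok2014, (2.2.1)] -/
@[simp]
theorem mul_z (a b : WeilGroupReal) :
    (a * b).z = a.z * (if a.e then weilConj b.z else b.z) * (if (a.e && b.e) then -1 else 1) :=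
  rfl

/-- The `j`-exponent of a product is the sum mod `2`. [folklore] -/
@[simp]
theorem mul_e (a b : WeilGroupReal) : (a * b).e = xor a.e b.e :=
  rfl

/-- The `ℂˣ`-coordinate of `1`. [folklore] -/
@[simp]
theorem one_z : (1 : WeilGroupReal).z = 1 :=
  rfl

/-- The `j`-exponent of `1`. [folklore] -/
@[simp]
theorem one_e : (1 : WeilGroupReal).e = false :=
  rfl

/-- The `ℂˣ`-coordinate of an inverse. [folklore] -/
@[simp]
theorem inv_z (a : WeilGroupReal) : a⁻¹.z = if a.e then -(weilConj a.z)⁻¹ else a.z⁻¹ :=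
  rfl

/-- The `j`-exponent of an inverse. [folklore] -/
@[simp]
theorem inv_e (a : WeilGroupReal) : a⁻¹.e = a.e :=
  rfl

/-- `W_ℝ` is a group. [cite: Mok2014, (2.2.1)] -/
instance : Group WeilGroupReal :=
  Group.ofLeftAxioms
    (fun a b c => by
      obtain ⟨z₁, e₁⟩ := a
      obtain ⟨z₂, e₂⟩ := b
      obtain ⟨z₃, e₃⟩ := c
      ext
      · cases e₁ <;> cases e₂ <;> cases e₃ <;> simp [mul_comm, mul_left_comm, mul_assoc]
      · cases e₁ <;> cases e₂ <;> cases e₃ <;> rfl)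
    (fun a => by
      obtain ⟨z, e⟩ := a
      ext <;> simp)
    (fun a => by
      obtain ⟨z, e⟩ := a
      ext
      · cases e <;> simp
      · cases e <;> rfl)

/-- The element `j ∈ W_ℝ ∖ W_ℂ` (`w_c`). [cite: Mok2014, §2.1–§2.2] -/
def j : WeilGroupReal :=
  ⟨1, true⟩

/-- `W_ℂ = ℂˣ ↪ W_ℝ`. [cite: Mok2014, (2.2.1)] -/
def ofUnits : ℂˣ →* WeilGroupReal where
  toFun z := ⟨z, false⟩
  map_one' := rfl
  map_mul' z w := by ext <;> simp

/-- The `ℂˣ`-coordinate of `z ∈ W_ℂ`. [folklore] -/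
@[simp]
theorem ofUnits_z (z : ℂˣ) : (ofUnits z).z = z :=
  rfl

/-- `W_ℂ` has `j`-exponent `0`. [folklore] -/
@[simp]
theorem ofUnits_e (z : ℂˣ) : (ofUnits z).e = false :=
  rfl

/-- The `ℂˣ`-coordinate of `j`. [folklore] -/
@[simp]
theorem j_z : j.z = 1 :=
  rfl

/-- The `j`-exponent of `j`. [folklore] -/
@[simp]
theorem j_e : j.e = true :=
  rfl

/-- **`j² = -1`.** [cite: Mok2014, Example before Cor. 2.5.5 ("`φ_v(j²) = φ_v(-1)`")] -/
theorem j_mul_j : j * j = ofUnits (-1) := by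
  ext <;> simp

/-- **`j⁻¹ z j = z̄`** (so `ρ^c(z) = ρ(w_c⁻¹ z w_c) = ρ(z̄)` for `w_c = j`). [cite: Mok2014, (2.2.3)] -/
theorem j_inv_mul_ofUnits_mul_j (z : ℂˣ) : j⁻¹ * ofUnits z * j = ofUnits (weilConj z) := by
  ext <;> simp

/-- `j z j⁻¹ = z̄`. [folklore] -/
theorem j_mul_ofUnits_mul_j_inv (z : ℂˣ) : j * ofUnits z * j⁻¹ = ofUnits (weilConj z) := by
  ext <;> simp

/-- **The sign character `W_ℝ → W_ℝ / W_ℂ = Gal(ℂ/ℝ) = {±1}`** (the index-two datum `s` of the abstract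
sections, kernel `W_ℂ`). [cite: Mok2014, §2.1] -/
def sign : WeilGroupReal →* ℤˣ where
  toFun a := if a.e then -1 else 1
  map_one' := by simp
  map_mul' a b := by
    obtain ⟨z, e⟩ := a
    obtain ⟨w, f⟩ := b
    cases e <;> cases f <;> simp

/-- Unfolding `sign`. [folklore] -/
@[simp]
theorem sign_apply (a : WeilGroupReal) : sign a = if a.e then -1 else 1 :=
  rfl

/-- `sign j = -1`: `j ∈ W_ℝ ∖ W_ℂ`. [cite: Mok2014, §2.1] -/
theorem sign_j : sign j = -1 := by
  simp

/-- `ker(sign) = W_ℂ` (the elements with `j`-exponent `0`). [cite: Mok2014, (2.2.1)] -/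
theorem mem_ker_sign_iff (a : WeilGroupReal) : a ∈ sign.ker ↔ a.e = false := by
  have hne : (-1 : ℤˣ) ≠ 1 := by decide
  rw [MonoidHom.mem_ker, sign_apply]
  cases a.e <;> simp [hne]

/-- **`W_ℂ = ℂˣ ≃ ker(sign)`.** [cite: Mok2014, (2.2.1)] -/
def unitsEquivKer : ℂˣ ≃* sign.ker where
  toFun z := ⟨ofUnits z, by rw [mem_ker_sign_iff]; rfl⟩
  invFun a := a.1.z
  left_inv z := rfl
  right_inv a := by
    obtain ⟨⟨z, e⟩, ha⟩ := a
    have he : e = false := by rwa [mem_ker_sign_iff] at ha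
    subst he
    rfl
  map_mul' z w := Subtype.ext (map_mul ofUnits z w)

/-- Unfolding `unitsEquivKer`. [folklore] -/
@[simp]
theorem coe_unitsEquivKer (z : ℂˣ) : ((unitsEquivKer z : sign.ker) : WeilGroupReal) = ofUnits z :=
  rfl

/-- `w_c⁻¹ z w_c = z̄` inside `ker(sign)`. [cite: Mok2014, (2.2.3)] -/
theorem kerConj_unitsEquivKer (z : ℂˣ) : kerConj sign j (unitsEquivKer z) = unitsEquivKer (weilConj z) :=
  Subtype.ext (by rw [coe_kerConj_apply, coe_unitsEquivKer, coe_unitsEquivKer, j_inv_mul_ofUnits_mul_j])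

/-- `w_c² = j² = -1` inside `ker(sign)`. [cite: Mok2014, Example before Cor. 2.5.5] -/
theorem wcSq_sign_j : wcSq sign j sign_j = unitsEquivKer (-1) :=
  Subtype.ext j_mul_j

end WeilGroupReal

open WeilGroupReal

variable {ι : Type*} [Fintype ι] [DecidableEq ι]

/-- A matrix-valued parameter `ρ : W_ℂ = ℂˣ → M_n(ℂ)` (a monoid homomorphism, as in
`ConjSelfDualParityDiagonal`) viewed as a `GL_n(ℂ)`-valued parameter of `W_ℂ = ker(sign) ⊂ W_ℝ`. [folklore] -/
def archParamGL (ρ : ℂˣ →* Matrix ι ι ℂ) : sign.ker →* GL ι ℂ :=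
  ρ.toHomUnits.comp unitsEquivKer.symm.toMonoidHom

/-- The matrix of `archParamGL ρ` at `z ∈ W_ℂ` is `ρ(z)`. [folklore] -/
@[simp]
theorem coe_archParamGL_unitsEquivKer (ρ : ℂˣ →* Matrix ι ι ℂ) (z : ℂˣ) :
    ((archParamGL ρ (unitsEquivKer z) : GL ι ℂ) : Matrix ι ι ℂ) = ρ z := by
  simp [archParamGL]

/-- **The abstract parity (2.2.6) at `W_ℂ ⊂ W_ℝ`, `w_c = j`, is the matrix-form parity of
`ConjSelfDualParityDiagonal`** (`ρ^c(z) = ρ(z̄)`, `ρ(w_c²) = ρ(-1)`). [cite: Mok2014, (2.2.5)–(2.2.6)] -/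
theorem isConjSelfDualOfParityGL_archParamGL_iff (ρ : ℂˣ →* Matrix ι ι ℂ) (η : ℤˣ) :
    IsConjSelfDualOfParityGL sign j sign_j (archParamGL ρ) η ↔ IsConjSelfDualOfParity ρ η := by
  constructor
  · rintro ⟨A, hinv, hsgn⟩
    refine ⟨(A : Matrix ι ι ℂ), Matrix.isUnits_det_units A, fun z => ?_, ?_⟩
    · have h := congrArg (fun g : GL ι ℂ => (g : Matrix ι ι ℂ)) (hinv (unitsEquivKer z))
      simpa only [Units.val_mul, coe_transposeGL, conjParam_apply, kerConj_unitsEquivKer,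
        coe_archParamGL_unitsEquivKer] using h
    · have h := congrArg (fun g : GL ι ℂ => (g : Matrix ι ι ℂ)) hsgn
      simpa only [Units.val_mul, coe_transposeGL, coe_signGL, wcSq_sign_j, coe_archParamGL_unitsEquivKer,
        smul_mul_assoc, one_mul, Matrix.mul_assoc] using h
  · rintro ⟨A, hA, hinv, hsgn⟩
    have hA' : IsUnit A := (Matrix.isUnit_iff_isUnit_det A).mpr hA
    refine ⟨hA'.unit, fun σ => ?_, ?_⟩
    · obtain ⟨z, rfl⟩ := unitsEquivKer.surjective σ
      apply Units.ext
      simp only [Units.val_mul, coe_transposeGL, conjParam_apply, kerConj_unitsEquivKer,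
        coe_archParamGL_unitsEquivKer, IsUnit.unit_spec]
      exact hinv z
    · apply Units.ext
      simp only [Units.val_mul, coe_transposeGL, coe_signGL, wcSq_sign_j, coe_archParamGL_unitsEquivKer,
        IsUnit.unit_spec, smul_mul_assoc, one_mul]
      exact hsgn

/-- The unitary characters `(z/|z|)^m` of `W_ℂ` (`unitArgChar`, values in `ℂˣ`) as characters of
`ker(sign) ⊂ W_ℝ`. [cite: Mok2014, (2.5.12)] -/
def archUnitArgChar (m : ℤ) : sign.ker →* ℂˣ :=
  (unitArgChar m).toHomUnits.comp unitsEquivKer.symm.toMonoidHom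

/-- The value of `archUnitArgChar m` at `z ∈ W_ℂ` is `(z/|z|)^m`. [cite: Mok2014, (2.5.12)] -/
@[simp]
theorem coe_archUnitArgChar_unitsEquivKer (m : ℤ) (z : ℂˣ) :
    ((archUnitArgChar m (unitsEquivKer z) : ℂˣ) : ℂ) = unitArgChar m z := by
  simp [archUnitArgChar]

/-- **`𝒵_ℂ^±` at the archimedean place**: the character `(z/|z|)^m = (z/z̄)^{m/2}` of `W_ℂ` is conjugate
self-dual (`χ(z̄) χ(z) = 1`) of sign `χ(j²) = χ(-1) = (-1)^m`: sign `+1` for `m` even (e.g. `χ_+ = 1`), `-1`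
for `m` odd (`χ|_{ℝˣ} = sgn`, the character `ω_{ℂ/ℝ}`). [cite: Mok2014, (2.1.7)–(2.1.8) and (2.5.12)] -/
theorem isConjSelfDualCharOfSign_archUnitArgChar (m : ℤ) (κ : ℤˣ) (hκ : (-1 : ℂ) ^ m = ((κ : ℤ) : ℂ)) :
    IsConjSelfDualCharOfSign sign j sign_j (archUnitArgChar m) κ where
  conj_mul σ := by
    obtain ⟨z, rfl⟩ := unitsEquivKer.surjective σ
    apply Units.ext
    rw [kerConj_unitsEquivKer, Units.val_mul, coe_archUnitArgChar_unitsEquivKer, coe_archUnitArgChar_unitsEquivKer,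
      unitArgChar_weilConj_mul, Units.val_one]
  map_wcSq := by
    apply Units.ext
    rw [wcSq_sign_j, coe_archUnitArgChar_unitsEquivKer, unitArgChar_neg_one, coe_signUnit, hκ]

/-- `(z/|z|)^m ∈ 𝒵_ℂ^+` for `m` even. [cite: Mok2014, §2.1] -/
theorem isConjSelfDualCharOfSign_archUnitArgChar_of_even {m : ℤ} (hm : Even m) :
    IsConjSelfDualCharOfSign sign j sign_j (archUnitArgChar m) 1 :=
  isConjSelfDualCharOfSign_archUnitArgChar m 1 (by rw [hm.neg_one_zpow]; simp)

/-- `(z/|z|)^m ∈ 𝒵_ℂ^-` for `m` odd. [cite: Mok2014, §2.1] -/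
theorem isConjSelfDualCharOfSign_archUnitArgChar_of_odd {m : ℤ} (hm : Odd m) :
    IsConjSelfDualCharOfSign sign j sign_j (archUnitArgChar m) (-1) :=
  isConjSelfDualCharOfSign_archUnitArgChar m (-1) (by rw [hm.neg_one_zpow]; simp)

/-- **The local half of Mok's proof of Cor. 2.5.5, assembled at the archimedean place.**  Let
`φ : W_ℝ → ᴸU(N)` be an `L`-homomorphism (this is what Thm. 2.4.10 provides for the localization `φ^N_v` of
a conjugate self-dual cuspidal `Π` of sign `κ` at a real place `v` of `F` inert in `E`: "`φ^N_v` factors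
through `ξ_{χ_κ}`") and `χ_κ ∈ 𝒵_ℂ^κ`; suppose the parameter `φ|_{W_ℂ} ⊗ χ_κ` of `GL_N(ℂ)` (= `φ^N_v`) is
`GL_N(ℂ)`-conjugate to the multiplicity-free shape (2.5.12) `z ↦ diag((z/|z|)^{m_1}, …, (z/|z|)^{m_N})`,
`m_i` distinct (`a_i = m_i / 2`).  Then every `a_i` lies in `(N-1)/2 + (1-κ)/4 + ℤ` — Lemma 2.2.1 gives parity
`(-1)^{N-1} κ` (`IsLHom.isConjSelfDualOfParityGL_twistParam`), which passes to the conjugate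
(`IsConjSelfDualOfParityGL.of_eq_conj`), is the matrix parity of `ConjSelfDualParityDiagonal`
(`isConjSelfDualOfParityGL_archParamGL_iff`), and Remark 2.2.2 / the Example before Cor. 2.5.5 read off the
exponents (`exists_half_eq_of_isConjSelfDualOfParity_unitaryDiagParam`).  This is exactly the conclusion of
the named facts `Mok2014_archimedean_parity_of_asaiSign(Cont)`; their remaining inputs — Thm. 2.4.10 itself
and the local Langlands correspondence for `GL_N(ℂ)` identifying `HasArchParameter` with `φ^N_v` — are not in
the tree and are not used here. [cite: Mok2014, Lemma 2.2.1, Remark 2.2.2, Example before Cor. 2.5.5, Cor. 2.5.5] -/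
theorem exists_half_eq_of_isLHom_of_eq_conj_unitaryDiagParam {N : ℕ}
    {φ : WeilGroupReal →* LGroupU ℂ N sign} (hφ : IsLHom φ) {χ : sign.ker →* ℂˣ} {κ : ℤˣ}
    (hχ : IsConjSelfDualCharOfSign sign j sign_j χ κ) {m : Fin N → ℤ} (hm : Function.Injective m)
    (g : GL (Fin N) ℂ)
    (hg : ∀ σ, twistParam hφ.restrict χ σ = g * archParamGL (unitaryDiagParam m) σ * g⁻¹) (i : Fin N) :
    ∃ k : ℤ, (m i : ℂ) / 2 = (k : ℂ) + ((N : ℂ) - 1) / 2 + (1 - ((κ : ℤ) : ℂ)) / 4 :=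
  exists_half_eq_of_isConjSelfDualOfParity_unitaryDiagParam hm
    ((isConjSelfDualOfParityGL_archParamGL_iff _ _).mp
      ((hφ.isConjSelfDualOfParityGL_twistParam sign_j hχ).of_eq_conj g hg)) i

end WeilReal

end Literature.NumberTheory.Automorphic
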